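import Literature.MathematicalPhysics.QuantumLattice.HubbardUVSymbolResummedBandJetsFactorial
import Literature.MathematicalPhysics.QuantumLattice.HubbardUVSymbolJetsGeometric
import HarnessLib

/-!
# Jets of the three DRESSING/DEFECT factors of the mismatch-resummed two-leg reading along the frames, single factorial:
# `Ψ₁ = Ψ(ω, u+v)`, the defect `d = Ψ̃ − Ψ₁`, `J₂ = −(v²/c)·Ψ̃`, `J₁ = (1 − (v/c)Ψ̃)² − 1`

Topic `MathematicalPhysics/QuantumLattice`; sequel of `HubbardUVSymbolResummedBandJetsFactorial` (`Ψ̃` along the frames: `X|c|(6/Λ)·n!·(2ρ₂)ⁿ`) and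
`HubbardUVSymbolJetsGeometric` (`‖∂ᵏΨ‖ ≤ |c|X·k!·(4/Λ)^{k+1}`).  These are the smooth factors `g` of the tree/dressing data of the corrected (B) door of the
K3 two-leg reading (cell gate-hubbard-kl, stub (C) «(C)-B-REP», memo SUP-ROUTE-SPEC §1–§2: data `(g·P)∘p`, `g ∈ {d, J₁, J₂}`), whose sup-norms of
momentum derivatives feed the aliasing tail (`Literature.Analysis.Fourier.TorusFourierTailSmooth`); `u = e_{K₂}`, `v = D = K₂ ⊖ K₁`, `u + v = e_{K₁}`.
All by the factorial-geometric calculus (`IteratedDerivCompFactorial`, `IteratedDerivMulFactorialPow`):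

* `norm_iteratedFDeriv_uvSymbol_comp_le_factorial` — `‖Dⁿ[Ψ(ω, u+v)](p)‖ ≤ |c|X(4/Λ)·n!·ρ₃ⁿ`, `ρ₃ = 4(E_u+F_v)(1 + (4/Λ)(1+δ))`;
* `norm_iteratedFDeriv_defect_le_factorial` — `‖Dⁿ d(p)‖ ≤ 2X|c|(6/Λ)·n!·(2ρ₂ + ρ₃)ⁿ`;
* `norm_iteratedFDeriv_sq_le_factorial` — `‖Dⁿ(v²)(p)‖ ≤ δ²·n!·(2F_v)ⁿ`;
* `norm_iteratedFDeriv_J₂_le_factorial` — `‖Dⁿ[−(v²/c)·Ψ̃](p)‖ ≤ (δ²/|c|)·X|c|(6/Λ)·n!·(2(2F_v + 2ρ₂))ⁿ`;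
* `norm_iteratedFDeriv_kappaPsi_le_factorial`, **`norm_iteratedFDeriv_J₁_le_factorial`** — `‖Dⁿ[(1 − (v/c)Ψ̃)² − 1](p)‖ ≤ a(a+2)·n!·(4ρ₆)ⁿ`,
  `a = (δ/|c|)·X|c|(6/Λ)`, `ρ₆ = 2F_v + 2ρ₂`.

Everything is proved; no definitions; no named facts.

## Sources

G. Benfatto, A. Giuliani, V. Mastropietro, Ann. Henri Poincaré 7 (2006) 809–898, §2.2 (2.23), (2.27)–(2.28), (2.36aa), §3 (3.2) [`BenfattoGiulianiMastropietro2006`];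
J. Feldman, M. Salmhofer, E. Trubowitz, J. Stat. Phys. 84 (1996) 1209–1336, §1 [`FeldmanSalmhoferTrubowitz1996`].
-/

noncomputable section

namespace Literature.MathematicalPhysics.QuantumLattice

open Complex Finset Literature.Analysis.Calculus
open scoped Nat

variable {c Λ ω : ℝ}

section Jets

variable {E : Type} [NormedAddCommGroup E] [NormedSpace ℝ E]

/-- **The plain symbol along the old frame's band `u + v`**: `‖Dⁿ[Ψ(ω, u+v)](p)‖ ≤ |c|X(4/Λ)·n!·(4(E_u+F_v)(1+(4/Λ)(1+δ)))ⁿ`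
(`‖Dⁱu‖ ≤ i!E_uⁱ`, `‖Dⁱv‖ ≤ δ·i!F_vⁱ`, `1 ≤ X`). [cite: BenfattoGiulianiMastropietro2006, §2.2 (2.36aa)] -/
theorem norm_iteratedFDeriv_uvSymbol_comp_le_factorial (hΛ : 0 < Λ) (hω : ω ≠ 0) {n : ℕ} {X : ℝ} (hX1 : 1 ≤ X)
    (hX : ∀ l ≤ n, ∀ x : ℝ, ‖iteratedFDeriv ℝ l salmhoferCutoff x‖ ≤ X) {u v : E → ℝ} (hu : ContDiff ℝ (⊤ : ℕ∞) u) (hv : ContDiff ℝ (⊤ : ℕ∞) v)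
    {Eu Fv δ : ℝ} (hEu : 0 ≤ Eu) (hFv : 0 ≤ Fv) (hδ : 0 ≤ δ) (p : E)
    (hDu : ∀ i, 1 ≤ i → i ≤ n → ‖iteratedFDeriv ℝ i u p‖ ≤ i ! * Eu ^ i) (hDv : ∀ i ≤ n, ‖iteratedFDeriv ℝ i v p‖ ≤ δ * i ! * Fv ^ i) :
    ‖iteratedFDeriv ℝ n (fun q : E => uvSymbolFnXi c Λ ω (u q + v q)) p‖ ≤
      |c| * X * (4 / Λ) * n ! * (4 * (Eu + Fv) * (1 + 4 / Λ * (1 + δ))) ^ n := by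
  have hcomp : (fun q : E => uvSymbolFnXi c Λ ω (u q + v q)) = uvSymbolFnXi c Λ ω ∘ (fun q => u q + v q) := rfl
  rw [hcomp]
  have huv : ContDiff ℝ (⊤ : ℕ∞) (fun q => u q + v q) := hu.add hv
  have hEF : 0 ≤ Eu + Fv := by positivity
  have hD : ∀ i, 1 ≤ i → i ≤ n → ‖iteratedFDeriv ℝ i (fun q => u q + v q) p‖ ≤ (1 + δ) * i ! * (Eu + Fv) ^ i := by
    intro i hi1 hin
    have hiN : ((i : ℕ∞) : WithTop ℕ∞) ≤ ((⊤ : ℕ∞) : WithTop ℕ∞) := by exact_mod_cast le_top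
    rw [fun_iteratedFDeriv_add_apply (hu.contDiffAt.of_le hiN) (hv.contDiffAt.of_le hiN)]
    refine (norm_add_le _ _).trans ?_
    have h1 : ‖iteratedFDeriv ℝ i u p‖ ≤ i ! * (Eu + Fv) ^ i :=
      (hDu i hi1 hin).trans (mul_le_mul_of_nonneg_left (pow_le_pow_left₀ hEu (by linarith) i) (by positivity))
    have h2 : ‖iteratedFDeriv ℝ i v p‖ ≤ δ * i ! * (Eu + Fv) ^ i :=
      (hDv i hin).trans (mul_le_mul_of_nonneg_left (pow_le_pow_left₀ hFv (by linarith) i) (by positivity))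
    calc ‖iteratedFDeriv ℝ i u p‖ + ‖iteratedFDeriv ℝ i v p‖ ≤ i ! * (Eu + Fv) ^ i + δ * i ! * (Eu + Fv) ^ i := add_le_add h1 h2
      _ = (1 + δ) * i ! * (Eu + Fv) ^ i := by ring
  have h := norm_iteratedFDeriv_comp_le_of_factorial (F := ℝ) (G := ℂ) huv p (B := 1 + δ) (σ := Eu + Fv) (τ := 4 / Λ) (by positivity) hEF
    (by positivity) n hD (contDiff_uvSymbolFnXi (c := c) (Λ := Λ) hω) (|c| * X * (4 / Λ)) 0
    (fun k hk => by
      rw [add_zero]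
      refine (norm_iteratedFDeriv_uvSymbolFnXi_le_geometric hΛ hω hX1 (fun l hl x => hX l (hl.trans hk) x) _).trans (le_of_eq ?_)
      rw [pow_succ]; ring)
  simpa [add_zero] using h

/-- **The square of the mismatch**: `‖Dⁿ(v²)(p)‖ ≤ δ²·n!·(2F_v)ⁿ`. [cite: BenfattoGiulianiMastropietro2006, §3 (3.2)] -/
theorem norm_iteratedFDeriv_sq_le_factorial {n : ℕ} {v : E → ℝ} (hv : ContDiff ℝ (⊤ : ℕ∞) v) {Fv δ : ℝ} (hFv : 0 ≤ Fv) (hδ : 0 ≤ δ) (p : E)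
    (hDv : ∀ i ≤ n, ‖iteratedFDeriv ℝ i v p‖ ≤ δ * i ! * Fv ^ i) :
    ‖iteratedFDeriv ℝ n (fun q : E => v q * v q) p‖ ≤ δ * δ * n ! * (2 * Fv) ^ n := by
  have h := norm_iteratedFDeriv_mul_le_of_factorialPow (N := ((⊤ : ℕ∞) : WithTop ℕ∞)) (a := 1) (b := 1) hv hv (by exact_mod_cast le_top) p hδ hδ hFv
    (fun i hi => by rw [pow_one]; exact hDv i hi) (fun i hi => by rw [pow_one]; exact hDv i hi)
  rw [max_self, pow_one] at h
  exact h

/-- **`J₂ = −(v²/c)·Ψ̃`** along the frames: `‖Dⁿ J₂(p)‖ ≤ (δ²/|c|)·(X|c|(6/Λ))·n!·(2(2F_v + 2ρ₂))ⁿ` (hypotheses of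
`norm_iteratedFDeriv_uvResummed_comp_le_factorial`). [cite: BenfattoGiulianiMastropietro2006, §2.2 (2.23)] -/
theorem norm_iteratedFDeriv_J₂_le_factorial (hΛ : 0 < Λ) (hω : ω ≠ 0) {n : ℕ} {X : ℝ}
    (hX : ∀ l ≤ n, ∀ x : ℝ, ‖iteratedFDeriv ℝ l salmhoferCutoff x‖ ≤ X) {u v : E → ℝ} (hu : ContDiff ℝ (⊤ : ℕ∞) u) (hv : ContDiff ℝ (⊤ : ℕ∞) v)
    {Eu Fv δ : ℝ} (hEu : 0 ≤ Eu) (hFv : 0 ≤ Fv) (hδ : 0 ≤ δ) (hδΛ : δ ≤ Λ / 4) (p : E) (hvp : |v p| ≤ δ)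
    (hDu : ∀ i, 1 ≤ i → i ≤ n → ‖iteratedFDeriv ℝ i u p‖ ≤ i ! * Eu ^ i) (hDv : ∀ i ≤ n, ‖iteratedFDeriv ℝ i v p‖ ≤ δ * i ! * Fv ^ i) :
    ‖iteratedFDeriv ℝ n (fun q : E => -((((v q * v q) / c : ℝ)) : ℂ) *
        (((uvWeightFn Λ ω (u q) : ℝ) : ℂ) * resolventFnXi c 0 ω (u q + uvWeightFn Λ ω (u q) * v q))) p‖ ≤
      (δ * δ / |c|) * (X * (|c| * (6 / Λ))) * n ! *
        (2 * (2 * Fv + 2 * (8 * (4 * Eu * (1 + 4 / Λ * 1) + Fv) * (1 + 6 / Λ * (1 + δ * X))))) ^ n := by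
  have hX0 : 0 ≤ X := (norm_nonneg _).trans (hX 0 (Nat.zero_le _) 0)
  set ρ₂ : ℝ := 8 * (4 * Eu * (1 + 4 / Λ * 1) + Fv) * (1 + 6 / Λ * (1 + δ * X)) with hρ₂
  have hρ₂0 : 0 ≤ ρ₂ := by rw [hρ₂]; positivity
  set ρ : ℝ := 2 * Fv + 2 * ρ₂ with hρ
  have hρ0 : 0 ≤ ρ := by rw [hρ]; positivity
  -- the scalar factor `−(v²/c)` as a complex-valued function
  have hω0 : ω + 0 ≠ 0 := by rwa [add_zero]
  have hvv : ContDiff ℝ (⊤ : ℕ∞) (fun q : E => v q * v q) := hv.mul hv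
  have hsc : ContDiff ℝ (⊤ : ℕ∞) (fun q : E => -((((v q * v q) / c : ℝ)) : ℂ)) :=
    (Complex.ofRealCLM.contDiff.comp (hvv.div_const c)).neg
  have hΨ : ContDiff ℝ (⊤ : ℕ∞) (fun q : E => ((uvWeightFn Λ ω (u q) : ℝ) : ℂ) * resolventFnXi c 0 ω (u q + uvWeightFn Λ ω (u q) * v q)) :=
    (Complex.ofRealCLM.contDiff.comp ((contDiff_uvWeightFn_band Λ ω).comp hu)).mul
      ((contDiff_resolventFnXi (c := c) hω0).comp (hu.add (((contDiff_uvWeightFn_band Λ ω).comp hu).mul hv)))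
  -- jets of the scalar factor: `(δ²/|c|)·i!·(2F_v)ⁱ`
  have hA : ∀ i ≤ n, ‖iteratedFDeriv ℝ i (fun q : E => -((((v q * v q) / c : ℝ)) : ℂ)) p‖ ≤ (δ * δ / |c|) * ((i ! : ℝ)) ^ 1 * ρ ^ i := by
    intro i hi
    have hiN : ((i : ℕ∞) : WithTop ℕ∞) ≤ ((⊤ : ℕ∞) : WithTop ℕ∞) := by exact_mod_cast le_top
    have hneg : (fun q : E => -((((v q * v q) / c : ℝ)) : ℂ)) = -(fun q : E => ((((v q * v q) / c : ℝ)) : ℂ)) := rfl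
    rw [hneg, iteratedFDeriv_neg_apply, norm_neg]
    have hcast : (fun q : E => ((((v q * v q) / c : ℝ)) : ℂ)) = Complex.ofRealLI ∘ (fun q : E => (v q * v q) / c) := rfl
    rw [hcast, Complex.ofRealLI.norm_iteratedFDeriv_comp_left ((hvv.div_const c).contDiffAt.of_le hiN) le_rfl]
    have hdiv : (fun q : E => v q * v q / c) = fun q => c⁻¹ • (v q * v q) := by funext q; rw [smul_eq_mul]; ring
    rw [hdiv, iteratedFDeriv_const_smul_apply' (hvv.contDiffAt.of_le hiN), norm_smul, norm_inv, Real.norm_eq_abs, pow_one]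
    refine (mul_le_mul_of_nonneg_left (norm_iteratedFDeriv_sq_le_factorial (n := i) hv hFv hδ p (fun j hj => hDv j (hj.trans hi))) (by positivity)).trans ?_
    have hF : (2 * Fv) ^ i ≤ ρ ^ i := pow_le_pow_left₀ (by positivity) (by rw [hρ]; linarith) i
    calc |c|⁻¹ * (δ * δ * (i ! : ℝ) * (2 * Fv) ^ i) ≤ |c|⁻¹ * (δ * δ * (i ! : ℝ) * ρ ^ i) := by gcongr
      _ = δ * δ / |c| * (i ! : ℝ) * ρ ^ i := by rw [div_eq_mul_inv]; ring
  have hB : ∀ i ≤ n, ‖iteratedFDeriv ℝ i (fun q : E => ((uvWeightFn Λ ω (u q) : ℝ) : ℂ) * resolventFnXi c 0 ω (u q + uvWeightFn Λ ω (u q) * v q)) p‖ ≤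
      (X * (|c| * (6 / Λ))) * ((i ! : ℝ)) ^ 1 * ρ ^ i := by
    intro i hi
    rw [pow_one]
    refine (norm_iteratedFDeriv_uvResummed_comp_le_factorial hΛ hω (fun l hl x => hX l (hl.trans hi) x) hu hv hEu hFv hδ hδΛ p hvp
      (fun j hj1 hj => hDu j hj1 (hj.trans hi)) (fun j hj => hDv j (hj.trans hi))).trans ?_
    refine mul_le_mul_of_nonneg_left (pow_le_pow_left₀ (by positivity) ?_ i) (by positivity)
    rw [hρ]; linarith
  have h := norm_iteratedFDeriv_mul_le_of_factorialPow (N := ((⊤ : ℕ∞) : WithTop ℕ∞)) (a := 1) (b := 1) hsc hΨ (by exact_mod_cast le_top) p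
    (by positivity) (by positivity) hρ0 hA hB
  rw [max_self, pow_one] at h
  exact h

/-- **`κΨ̃ = (v/c)·Ψ̃`**: `‖Dⁿ(κΨ̃)(p)‖ ≤ (δ/|c|)·(X|c|(6/Λ))·n!·(2(2F_v + 2ρ₂))ⁿ` (crudely `F_v ≤ 2F_v` for a common ratio).
[cite: BenfattoGiulianiMastropietro2006, §2.2 (2.23)] -/
theorem norm_iteratedFDeriv_kappaPsi_le_factorial (hΛ : 0 < Λ) (hω : ω ≠ 0) {n : ℕ} {X : ℝ}
    (hX : ∀ l ≤ n, ∀ x : ℝ, ‖iteratedFDeriv ℝ l salmhoferCutoff x‖ ≤ X) {u v : E → ℝ} (hu : ContDiff ℝ (⊤ : ℕ∞) u) (hv : ContDiff ℝ (⊤ : ℕ∞) v)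
    {Eu Fv δ : ℝ} (hEu : 0 ≤ Eu) (hFv : 0 ≤ Fv) (hδ : 0 ≤ δ) (hδΛ : δ ≤ Λ / 4) (p : E) (hvp : |v p| ≤ δ)
    (hDu : ∀ i, 1 ≤ i → i ≤ n → ‖iteratedFDeriv ℝ i u p‖ ≤ i ! * Eu ^ i) (hDv : ∀ i ≤ n, ‖iteratedFDeriv ℝ i v p‖ ≤ δ * i ! * Fv ^ i) :
    ‖iteratedFDeriv ℝ n (fun q : E => (((v q / c : ℝ)) : ℂ) *
        (((uvWeightFn Λ ω (u q) : ℝ) : ℂ) * resolventFnXi c 0 ω (u q + uvWeightFn Λ ω (u q) * v q))) p‖ ≤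
      (δ / |c|) * (X * (|c| * (6 / Λ))) * n ! *
        (2 * (2 * Fv + 2 * (8 * (4 * Eu * (1 + 4 / Λ * 1) + Fv) * (1 + 6 / Λ * (1 + δ * X))))) ^ n := by
  have hX0 : 0 ≤ X := (norm_nonneg _).trans (hX 0 (Nat.zero_le _) 0)
  set ρ₂ : ℝ := 8 * (4 * Eu * (1 + 4 / Λ * 1) + Fv) * (1 + 6 / Λ * (1 + δ * X)) with hρ₂
  have hρ₂0 : 0 ≤ ρ₂ := by rw [hρ₂]; positivity
  set ρ : ℝ := 2 * Fv + 2 * ρ₂ with hρ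
  have hρ0 : 0 ≤ ρ := by rw [hρ]; positivity
  have hω0 : ω + 0 ≠ 0 := by rwa [add_zero]
  have hsc : ContDiff ℝ (⊤ : ℕ∞) (fun q : E => (((v q / c : ℝ)) : ℂ)) := Complex.ofRealCLM.contDiff.comp (hv.div_const c)
  have hΨ : ContDiff ℝ (⊤ : ℕ∞) (fun q : E => ((uvWeightFn Λ ω (u q) : ℝ) : ℂ) * resolventFnXi c 0 ω (u q + uvWeightFn Λ ω (u q) * v q)) :=
    (Complex.ofRealCLM.contDiff.comp ((contDiff_uvWeightFn_band Λ ω).comp hu)).mul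
      ((contDiff_resolventFnXi (c := c) hω0).comp (hu.add (((contDiff_uvWeightFn_band Λ ω).comp hu).mul hv)))
  have hA : ∀ i ≤ n, ‖iteratedFDeriv ℝ i (fun q : E => (((v q / c : ℝ)) : ℂ)) p‖ ≤ (δ / |c|) * ((i ! : ℝ)) ^ 1 * ρ ^ i := by
    intro i hi
    have hiN : ((i : ℕ∞) : WithTop ℕ∞) ≤ ((⊤ : ℕ∞) : WithTop ℕ∞) := by exact_mod_cast le_top
    have hcast : (fun q : E => (((v q / c : ℝ)) : ℂ)) = Complex.ofRealLI ∘ (fun q : E => v q / c) := rfl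
    rw [hcast, Complex.ofRealLI.norm_iteratedFDeriv_comp_left ((hv.div_const c).contDiffAt.of_le hiN) le_rfl]
    have hdiv : (fun q : E => v q / c) = fun q => c⁻¹ • v q := by funext q; rw [smul_eq_mul]; ring
    rw [hdiv, iteratedFDeriv_const_smul_apply' (hv.contDiffAt.of_le hiN), norm_smul, norm_inv, Real.norm_eq_abs, pow_one]
    refine (mul_le_mul_of_nonneg_left (hDv i hi) (by positivity)).trans ?_
    have hF : Fv ^ i ≤ ρ ^ i := pow_le_pow_left₀ hFv (by rw [hρ]; linarith) i
    calc |c|⁻¹ * (δ * (i ! : ℝ) * Fv ^ i) ≤ |c|⁻¹ * (δ * (i ! : ℝ) * ρ ^ i) := by gcongr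
      _ = δ / |c| * (i ! : ℝ) * ρ ^ i := by rw [div_eq_mul_inv]; ring
  have hB : ∀ i ≤ n, ‖iteratedFDeriv ℝ i (fun q : E => ((uvWeightFn Λ ω (u q) : ℝ) : ℂ) * resolventFnXi c 0 ω (u q + uvWeightFn Λ ω (u q) * v q)) p‖ ≤
      (X * (|c| * (6 / Λ))) * ((i ! : ℝ)) ^ 1 * ρ ^ i := by
    intro i hi
    rw [pow_one]
    refine (norm_iteratedFDeriv_uvResummed_comp_le_factorial hΛ hω (fun l hl x => hX l (hl.trans hi) x) hu hv hEu hFv hδ hδΛ p hvp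
      (fun j hj1 hj => hDu j hj1 (hj.trans hi)) (fun j hj => hDv j (hj.trans hi))).trans ?_
    refine mul_le_mul_of_nonneg_left (pow_le_pow_left₀ (by positivity) ?_ i) (by positivity)
    rw [hρ]; linarith
  have h := norm_iteratedFDeriv_mul_le_of_factorialPow (N := ((⊤ : ℕ∞) : WithTop ℕ∞)) (a := 1) (b := 1) hsc hΨ (by exact_mod_cast le_top) p
    (by positivity) (by positivity) hρ0 hA hB
  rw [max_self, pow_one] at h
  exact h


/-- **The single-scale defect `d = Ψ̃ − Ψ₁` along the frames**: `‖Dⁿd(p)‖ ≤ X|c|(6/Λ)·n!·(2ρ₂)ⁿ + |c|X(4/Λ)·n!·ρ₃ⁿ` (the two bounds of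
`norm_iteratedFDeriv_uvResummed_comp_le_factorial` and `norm_iteratedFDeriv_uvSymbol_comp_le_factorial`). [cite: BenfattoGiulianiMastropietro2006, §2.2 (2.27)–(2.28)] -/
theorem norm_iteratedFDeriv_defect_le_factorial (hΛ : 0 < Λ) (hω : ω ≠ 0) {n : ℕ} {X : ℝ} (hX1 : 1 ≤ X)
    (hX : ∀ l ≤ n, ∀ x : ℝ, ‖iteratedFDeriv ℝ l salmhoferCutoff x‖ ≤ X) {u v : E → ℝ} (hu : ContDiff ℝ (⊤ : ℕ∞) u) (hv : ContDiff ℝ (⊤ : ℕ∞) v)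
    {Eu Fv δ : ℝ} (hEu : 0 ≤ Eu) (hFv : 0 ≤ Fv) (hδ : 0 ≤ δ) (hδΛ : δ ≤ Λ / 4) (p : E) (hvp : |v p| ≤ δ)
    (hDu : ∀ i, 1 ≤ i → i ≤ n → ‖iteratedFDeriv ℝ i u p‖ ≤ i ! * Eu ^ i) (hDv : ∀ i ≤ n, ‖iteratedFDeriv ℝ i v p‖ ≤ δ * i ! * Fv ^ i) :
    ‖iteratedFDeriv ℝ n (fun q : E => ((uvWeightFn Λ ω (u q) : ℝ) : ℂ) * resolventFnXi c 0 ω (u q + uvWeightFn Λ ω (u q) * v q) -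
        uvSymbolFnXi c Λ ω (u q + v q)) p‖ ≤
      X * (|c| * (6 / Λ)) * n ! * (2 * (8 * (4 * Eu * (1 + 4 / Λ * 1) + Fv) * (1 + 6 / Λ * (1 + δ * X)))) ^ n +
        |c| * X * (4 / Λ) * n ! * (4 * (Eu + Fv) * (1 + 4 / Λ * (1 + δ))) ^ n := by
  have hω0 : ω + 0 ≠ 0 := by rwa [add_zero]
  have hnN : ((n : ℕ∞) : WithTop ℕ∞) ≤ ((⊤ : ℕ∞) : WithTop ℕ∞) := by exact_mod_cast le_top
  have hΨ : ContDiff ℝ (⊤ : ℕ∞) (fun q : E => ((uvWeightFn Λ ω (u q) : ℝ) : ℂ) * resolventFnXi c 0 ω (u q + uvWeightFn Λ ω (u q) * v q)) :=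
    (Complex.ofRealCLM.contDiff.comp ((contDiff_uvWeightFn_band Λ ω).comp hu)).mul
      ((contDiff_resolventFnXi (c := c) hω0).comp (hu.add (((contDiff_uvWeightFn_band Λ ω).comp hu).mul hv)))
  have hΨ₁ : ContDiff ℝ (⊤ : ℕ∞) (fun q : E => uvSymbolFnXi c Λ ω (u q + v q)) := (contDiff_uvSymbolFnXi (c := c) (Λ := Λ) hω).comp (hu.add hv)
  rw [fun_iteratedFDeriv_sub_apply (hΨ.contDiffAt.of_le hnN) (hΨ₁.contDiffAt.of_le hnN)]
  exact (norm_sub_le _ _).trans (add_le_add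
    (norm_iteratedFDeriv_uvResummed_comp_le_factorial hΛ hω hX hu hv hEu hFv hδ hδΛ p hvp hDu hDv)
    (norm_iteratedFDeriv_uvSymbol_comp_le_factorial hΛ hω hX1 hX hu hv hEu hFv hδ p hDu hDv))

/-- **`J₁ = (1 − κΨ̃)² − 1 = (κΨ̃)·(κΨ̃) − 2·(κΨ̃)`** along the frames: with `a = (δ/|c|)·X|c|(6/Λ)` and `ρ = 2(2F_v + 2ρ₂)`,
`‖Dⁿ J₁(p)‖ ≤ a·a·n!·(2ρ)ⁿ + 2·a·n!·ρⁿ`. [cite: BenfattoGiulianiMastropietro2006, §2.2 (2.23)] -/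
theorem norm_iteratedFDeriv_J₁_le_factorial (hΛ : 0 < Λ) (hω : ω ≠ 0) {n : ℕ} {X : ℝ}
    (hX : ∀ l ≤ n, ∀ x : ℝ, ‖iteratedFDeriv ℝ l salmhoferCutoff x‖ ≤ X) {u v : E → ℝ} (hu : ContDiff ℝ (⊤ : ℕ∞) u) (hv : ContDiff ℝ (⊤ : ℕ∞) v)
    {Eu Fv δ : ℝ} (hEu : 0 ≤ Eu) (hFv : 0 ≤ Fv) (hδ : 0 ≤ δ) (hδΛ : δ ≤ Λ / 4) (p : E) (hvp : |v p| ≤ δ)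
    (hDu : ∀ i, 1 ≤ i → i ≤ n → ‖iteratedFDeriv ℝ i u p‖ ≤ i ! * Eu ^ i) (hDv : ∀ i ≤ n, ‖iteratedFDeriv ℝ i v p‖ ≤ δ * i ! * Fv ^ i) :
    ‖iteratedFDeriv ℝ n (fun q : E =>
        ((((v q / c : ℝ)) : ℂ) * (((uvWeightFn Λ ω (u q) : ℝ) : ℂ) * resolventFnXi c 0 ω (u q + uvWeightFn Λ ω (u q) * v q))) *
          ((((v q / c : ℝ)) : ℂ) * (((uvWeightFn Λ ω (u q) : ℝ) : ℂ) * resolventFnXi c 0 ω (u q + uvWeightFn Λ ω (u q) * v q))) -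
        (2 : ℂ) * ((((v q / c : ℝ)) : ℂ) * (((uvWeightFn Λ ω (u q) : ℝ) : ℂ) * resolventFnXi c 0 ω (u q + uvWeightFn Λ ω (u q) * v q)))) p‖ ≤
      (δ / |c| * (X * (|c| * (6 / Λ)))) * (δ / |c| * (X * (|c| * (6 / Λ)))) * n ! *
          (2 * (2 * (2 * Fv + 2 * (8 * (4 * Eu * (1 + 4 / Λ * 1) + Fv) * (1 + 6 / Λ * (1 + δ * X)))))) ^ n +
        2 * ((δ / |c|) * (X * (|c| * (6 / Λ))) * n ! *
          (2 * (2 * Fv + 2 * (8 * (4 * Eu * (1 + 4 / Λ * 1) + Fv) * (1 + 6 / Λ * (1 + δ * X))))) ^ n) := by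
  have hω0 : ω + 0 ≠ 0 := by rwa [add_zero]
  have hX0 : 0 ≤ X := (norm_nonneg _).trans (hX 0 (Nat.zero_le _) 0)
  have hnN : ((n : ℕ∞) : WithTop ℕ∞) ≤ ((⊤ : ℕ∞) : WithTop ℕ∞) := by exact_mod_cast le_top
  set ρ : ℝ := 2 * (2 * Fv + 2 * (8 * (4 * Eu * (1 + 4 / Λ * 1) + Fv) * (1 + 6 / Λ * (1 + δ * X)))) with hρ
  have hρ0 : 0 ≤ ρ := by rw [hρ]; positivity
  have hK : ContDiff ℝ (⊤ : ℕ∞) (fun q : E => (((v q / c : ℝ)) : ℂ) *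
      (((uvWeightFn Λ ω (u q) : ℝ) : ℂ) * resolventFnXi c 0 ω (u q + uvWeightFn Λ ω (u q) * v q))) :=
    (Complex.ofRealCLM.contDiff.comp (hv.div_const c)).mul
      ((Complex.ofRealCLM.contDiff.comp ((contDiff_uvWeightFn_band Λ ω).comp hu)).mul
        ((contDiff_resolventFnXi (c := c) hω0).comp (hu.add (((contDiff_uvWeightFn_band Λ ω).comp hu).mul hv))))
  have hk : ∀ i ≤ n, ‖iteratedFDeriv ℝ i (fun q : E => (((v q / c : ℝ)) : ℂ) *
      (((uvWeightFn Λ ω (u q) : ℝ) : ℂ) * resolventFnXi c 0 ω (u q + uvWeightFn Λ ω (u q) * v q))) p‖ ≤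
      (δ / |c| * (X * (|c| * (6 / Λ)))) * ((i ! : ℝ)) ^ 1 * ρ ^ i := by
    intro i hi
    rw [pow_one]
    exact norm_iteratedFDeriv_kappaPsi_le_factorial hΛ hω (fun l hl x => hX l (hl.trans hi) x) hu hv hEu hFv hδ hδΛ p hvp
      (fun j hj1 hj => hDu j hj1 (hj.trans hi)) (fun j hj => hDv j (hj.trans hi))
  have hsq := norm_iteratedFDeriv_mul_le_of_factorialPow (N := ((⊤ : ℕ∞) : WithTop ℕ∞)) (a := 1) (b := 1) hK hK hnN p
    (by positivity) (by positivity) hρ0 hk hk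
  rw [max_self, pow_one] at hsq
  have h2 : ‖iteratedFDeriv ℝ n (fun q : E => (2 : ℂ) * ((((v q / c : ℝ)) : ℂ) *
      (((uvWeightFn Λ ω (u q) : ℝ) : ℂ) * resolventFnXi c 0 ω (u q + uvWeightFn Λ ω (u q) * v q)))) p‖ ≤
      2 * ((δ / |c|) * (X * (|c| * (6 / Λ))) * n ! * ρ ^ n) := by
    have hsm : (fun q : E => (2 : ℂ) * ((((v q / c : ℝ)) : ℂ) *
        (((uvWeightFn Λ ω (u q) : ℝ) : ℂ) * resolventFnXi c 0 ω (u q + uvWeightFn Λ ω (u q) * v q)))) =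
        fun q => (2 : ℂ) • ((((v q / c : ℝ)) : ℂ) * (((uvWeightFn Λ ω (u q) : ℝ) : ℂ) * resolventFnXi c 0 ω (u q + uvWeightFn Λ ω (u q) * v q))) := by
      funext q; rw [smul_eq_mul]
    rw [hsm, iteratedFDeriv_const_smul_apply' (hK.contDiffAt.of_le hnN), norm_smul, RCLike.norm_ofNat]
    have := hk n le_rfl
    rw [pow_one] at this
    exact mul_le_mul_of_nonneg_left this (by norm_num)
  rw [fun_iteratedFDeriv_sub_apply ((hK.mul hK).contDiffAt.of_le hnN) ((contDiff_const.mul hK).contDiffAt.of_le hnN)]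
  exact (norm_sub_le _ _).trans (add_le_add hsq h2)

end Jets

end Literature.MathematicalPhysics.QuantumLattice

end
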